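import Literature.NumberTheory.EllipticCurves.BernoulliDistributionRelationProofs
import Mathlib.NumberTheory.Padics.PadicIntegers
import Mathlib.Analysis.Normed.Group.Ultra
import Mathlib.NumberTheory.Multiplicity
import Mathlib.Data.ZMod.Basic
import HarnessLib

/-!
# The Bernoulli distributions `E_k^{(N)}`, their regularisations `E_{k,c}^{(N)}`, and the
# twisted measures `θ E_{k,c}` on `ℤ_p` (Lang Ch. 2 §2, Ch. 4 §3)

Lang, *Cyclotomic Fields I and II*, Ch. 2 §2 (PDF pp. 34–37): for `x ∈ ℤ/Nℤ`,
`E_k^{(N)}(x) = N^{k-1} (1/k) B_k(⟨x/N⟩)` is a distribution on `{ℤ/Nℤ}` (by **B 3**/**B 4**,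
`BernoulliDistributionRelationProofs`); for `c` prime to `N` the regularised distribution
`E_{k,c}^{(N)}(x) = E_k^{(N)}(x) − c^k E_k^{(N)}(c⁻¹x)` satisfies
**E 1** `E_{1,c}^{(N)}(x) = ⟨x/N⟩ − c⟨c⁻¹x/N⟩ + (c−1)/2` (so its values are `N`-integral, Thm. 2.1
(i)).  Ch. 4 §3 (PDF p. 84) integrates a Dirichlet character against `E_{1,c}`:
`L_p(1−s, χ) = −(1 − χ(c)⟨c⟩^s)⁻¹ ∫_{ℤ_p^*} ⟨a⟩^s χ(a) a⁻¹ dE_{1,c}(a)`.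

This file formalises these objects with the normalisation `k · E_k^{(N)}` (no division by `k`
inside `bernoulliDist`):

* `bernoulliDist k M b = M^{k-1} B_k(b.val/M)` (`= k E_k^{(M)}(b)`), `regBernoulliDist k M c b =
  bernoulliDist k M b − c^k bernoulliDist k M (b c⁻¹)` (`= k E_{k,c}^{(M)}(b)`);
* `sum_fiber_bernoulliDist`, `sum_fiber_regBernoulliDist` — the distribution relations between the
  levels `M ∣ M'`;
* `regBernoulliDist_one_eq` — **E 1**: `E_{1,c}^{(M)}(b) = (c−1)/2 − t` with `t ∈ ℕ` defined by
  `c · (bc⁻¹).val = b.val + tM`; `norm_regBernoulliDist_one_le_one` — Thm. 2.1 (i) at odd `p`;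
* `bernoulliMeasure p N c θ k n a = ∑_{b ∈ ℤ/Np^nℤ, b ≡ a (p^n)} θ(b) E_{k,c}^{(Np^n)}(b)` — the
  `θ`-twisted distribution `θ E_{k,c}` of level `N`, viewed on `ℤ_p` (the values
  `∫_{a + p^n ℤ_p} θ dE_{k,c}`), for an `N`-periodic `θ : ℕ → ℤ_p` (Lang Ch. 4 §3: `χ E_{1,c}`), and
  its distribution relation `sum_fiber_bernoulliMeasure` on the `p`-power tower.

Everything is proved; there are no named facts.

## References

* S. Lang, *Cyclotomic Fields I and II*, GTM 121, Springer 1990, Ch. 2 §2: **B 3**–**B 7**,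
  **E 1**, **E 2**, Theorem 2.1 (PDF pp. 34–37); Ch. 4 §3 (PDF p. 84). [LangCyclotomic1990]
-/

noncomputable section

open Finset Nat

namespace Literature.NumberTheory.EllipticCurves

/-! ### The distributions -/

/-- **`k · E_k^{(M)}(b) = M^{k-1} B_k(⟨b/M⟩)`** for `b ∈ ℤ/Mℤ` (Lang Ch. 2 §2, the display after
**B 4**; here without Lang's factor `1/k`), a rational number.
[cite: LangCyclotomic1990, Ch. 2 §2, definition of E_k^{(N)} (PDF p. 34)] -/
def bernoulliDist (k M : ℕ) (b : ZMod M) : ℚ :=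
  (M : ℚ) ^ (k - 1) * (Polynomial.bernoulli k).eval ((b.val : ℚ) / M)

/-- **`k · E_{k,c}^{(M)}(b) = k E_k^{(M)}(b) − c^k · k E_k^{(M)}(c⁻¹ b)`**, the regularised
Bernoulli distribution (Lang Ch. 2 §2, "`E_{k,c} = E_k − c^k E_k ∘ c⁻¹`"), for an integer `c`
prime to `M` (`c⁻¹` computed in `ℤ/Mℤ`).
[cite: LangCyclotomic1990, Ch. 2 §2, definition of E_{k,c}^{(N)} (PDF p. 35)] -/
def regBernoulliDist (k M c : ℕ) (b : ZMod M) : ℚ :=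
  bernoulliDist k M b - (c : ℚ) ^ k * bernoulliDist k M (b * (c : ZMod M)⁻¹)

/-! ### The fibres of `ℤ/M'ℤ → ℤ/Mℤ` for `M ∣ M'` -/

section Fiber

variable {M M' : ℕ} [NeZero M] [NeZero M'] (hMM' : M ∣ M')

include hMM' in
omit [NeZero M] in
/-- `M' = M · (M'/M)` and `0 < M'/M`. [folklore] -/
private theorem eq_mul_div_and_pos : M' = M * (M' / M) ∧ 0 < M' / M := by
  have h := (Nat.mul_div_cancel' hMM').symm
  refine ⟨h, Nat.pos_of_ne_zero fun h0 ↦ ?_⟩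
  rw [h0, mul_zero] at h
  exact NeZero.ne M' h

include hMM' in
/-- The classes of `b₀ + jM`, `j < M'/M`, in `ℤ/M'ℤ` have `val = b₀.val + jM`. [folklore] -/
private theorem val_natCast_add_mul (b₀ : ZMod M) (j : Fin (M' / M)) :
    ((b₀.val + (j : ℕ) * M : ℕ) : ZMod M').val = b₀.val + (j : ℕ) * M := by
  refine ZMod.val_natCast_of_lt ?_
  obtain ⟨hM', hr⟩ := eq_mul_div_and_pos hMM'
  have h1 := ZMod.val_lt b₀
  have h2 : (j : ℕ) * M ≤ (M' / M - 1) * M := Nat.mul_le_mul_right _ (by have := j.2; omega)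
  calc b₀.val + (j : ℕ) * M < M + (M' / M - 1) * M := by omega
    _ = M' := by
        conv_rhs => rw [hM']
        zify [hr]
        ring

/-- The fibre of `b₀ ∈ ℤ/Mℤ` in `ℤ/M'ℤ` consists of the classes of `b₀ + jM`, `j < M'/M`.
[folklore] -/
private theorem filter_castHom_eq_image_fin (b₀ : ZMod M) :
    Finset.univ.filter (fun b : ZMod M' ↦ ZMod.castHom hMM' (ZMod M) b = b₀) =
      Finset.univ.image (fun j : Fin (M' / M) ↦ ((b₀.val + (j : ℕ) * M : ℕ) : ZMod M')) := by
  classical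
  have hM : 0 < M := Nat.pos_of_ne_zero (NeZero.ne M)
  obtain ⟨hM', -⟩ := eq_mul_div_and_pos hMM'
  ext b
  simp only [Finset.mem_filter, Finset.mem_univ, true_and, Finset.mem_image]
  constructor
  · intro hb
    have hba : b.val % M = b₀.val := by
      have h := congr_arg ZMod.val hb
      rwa [ZMod.castHom_apply, ZMod.cast_eq_val, ZMod.val_natCast] at h
    have hlt : b.val / M < M' / M := by
      rw [Nat.div_lt_iff_lt_mul hM]
      calc b.val < M' := ZMod.val_lt b
        _ = M' / M * M := by rw [mul_comm]; exact hM'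
    refine ⟨⟨b.val / M, hlt⟩, ?_⟩
    dsimp only
    rw [← hba, Nat.mod_add_div', ZMod.natCast_zmod_val]
  · rintro ⟨j, rfl⟩
    rw [map_natCast, Nat.cast_add, Nat.cast_mul, ZMod.natCast_self, mul_zero, add_zero,
      ZMod.natCast_zmod_val]

/-- **Summation over a fibre**: for any `F`,
`∑_{b ∈ ℤ/M'ℤ, b ≡ b₀ (M)} F(b.val) = ∑_{j < M'/M} F(b₀.val + jM)`. [folklore] -/
private theorem sum_fiber_eq_sum_range {R : Type*} [AddCommMonoid R] (F : ℕ → R) (b₀ : ZMod M) :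
    ∑ b ∈ Finset.univ.filter (fun b : ZMod M' ↦ ZMod.castHom hMM' (ZMod M) b = b₀), F b.val =
      ∑ j ∈ range (M' / M), F (b₀.val + j * M) := by
  classical
  rw [filter_castHom_eq_image_fin hMM', Finset.sum_image]
  · simp_rw [val_natCast_add_mul hMM']
    exact Fin.sum_univ_eq_sum_range (fun j ↦ F (b₀.val + j * M)) (M' / M)
  · intro i _ j _ h
    have h' := congr_arg ZMod.val h
    rw [val_natCast_add_mul hMM', val_natCast_add_mul hMM'] at h'
    have hM : 0 < M := Nat.pos_of_ne_zero (NeZero.ne M)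
    exact Fin.ext (Nat.eq_of_mul_eq_mul_right hM (by omega))

/-- **Distribution relation of `E_k`** (Lang Ch. 2 §2, **B 4** "multiplying by `M^{k-1}` yields
precisely the distribution relation"): for `k ≥ 1` and `M ∣ M'`,
`∑_{b ≡ b₀ (M)} M'^{k-1} B_k(b.val/M') = M^{k-1} B_k(b₀.val/M)`.
[cite: LangCyclotomic1990, Ch. 2 §2, B 4 and the distribution E_k (PDF p. 34)] -/
theorem sum_fiber_bernoulliDist {k : ℕ} (hk : 1 ≤ k) (b₀ : ZMod M) :
    ∑ b ∈ Finset.univ.filter (fun b : ZMod M' ↦ ZMod.castHom hMM' (ZMod M) b = b₀),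
        bernoulliDist k M' b = bernoulliDist k M b₀ := by
  have hM : 0 < M := Nat.pos_of_ne_zero (NeZero.ne M)
  obtain ⟨hM', hr⟩ := eq_mul_div_and_pos hMM'
  unfold bernoulliDist
  rw [sum_fiber_eq_sum_range hMM' (fun x : ℕ ↦ (M' : ℚ) ^ (k - 1) *
      (Polynomial.bernoulli k).eval ((x : ℚ) / (M' : ℚ))) b₀]
  have h := sum_bernoulli_eval_fiber_eq hk hr hM b₀.val
  have hcast : ((M' / M * M : ℕ) : ℚ) = (M' : ℚ) := by
    rw [mul_comm, ← hM']
  rw [hcast] at h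
  exact h

omit [NeZero M] [NeZero M'] in
/-- Reduction of the inverse of `c` modulo `M'` is the inverse modulo `M` (`c` prime to `M'`).
[folklore] -/
private theorem castHom_inv_natCast {c : ℕ} (hc : c.Coprime M') :
    ZMod.castHom hMM' (ZMod M) ((c : ZMod M')⁻¹) = (c : ZMod M)⁻¹ := by
  symm
  refine ZMod.inv_eq_of_mul_eq_one M _ _ ?_
  have h := congr_arg (ZMod.castHom hMM' (ZMod M)) (ZMod.coe_mul_inv_eq_one c hc)
  rwa [map_mul, map_natCast, map_one] at h

omit [NeZero M] in
/-- **Change of variables `b ↦ c⁻¹ b` on a fibre**: multiplication by the unit `c⁻¹` of `ℤ/M'ℤ`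
maps the fibre of `b₀` bijectively onto the fibre of `c⁻¹ b₀`. [folklore] -/
private theorem sum_fiber_mul_inv {R : Type*} [AddCommMonoid R] (F : ZMod M' → R) {c : ℕ}
    (hc : c.Coprime M') (b₀ : ZMod M) :
    ∑ b ∈ Finset.univ.filter (fun b : ZMod M' ↦ ZMod.castHom hMM' (ZMod M) b = b₀),
        F (b * (c : ZMod M')⁻¹) =
      ∑ b ∈ Finset.univ.filter (fun b : ZMod M' ↦
        ZMod.castHom hMM' (ZMod M) b = b₀ * (c : ZMod M)⁻¹), F b := by
  have hcc : (c : ZMod M') * (c : ZMod M')⁻¹ = 1 := ZMod.coe_mul_inv_eq_one c hc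
  refine Finset.sum_nbij' (fun b ↦ b * (c : ZMod M')⁻¹) (fun b ↦ b * (c : ZMod M'))
    ?_ ?_ ?_ ?_ ?_
  · intro b hb
    simp only [Finset.mem_filter, Finset.mem_univ, true_and] at hb ⊢
    rw [map_mul, hb, castHom_inv_natCast hMM' hc]
  · intro b hb
    simp only [Finset.mem_filter, Finset.mem_univ, true_and] at hb ⊢
    rw [map_mul, hb, map_natCast, mul_assoc, ← castHom_inv_natCast hMM' hc, ← map_natCast
      (ZMod.castHom hMM' (ZMod M)) c, ← map_mul, mul_comm _ (c : ZMod M'), hcc,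
      map_one, mul_one]
  · intro b _
    rw [mul_assoc, mul_comm _ (c : ZMod M'), hcc, mul_one]
  · intro b _
    rw [mul_assoc, hcc, mul_one]
  · intro b _
    rfl

/-- **Distribution relation of `E_{k,c}`** (Lang Ch. 2 §2: `E_{k,c}` "is a distribution"): for
`k ≥ 1`, `M ∣ M'` and `c` prime to `M'`, `∑_{b ≡ b₀ (M)} k E_{k,c}^{(M')}(b) = k E_{k,c}^{(M)}(b₀)`.
[cite: LangCyclotomic1990, Ch. 2 §2, E_{k,c} (PDF p. 35)] -/
theorem sum_fiber_regBernoulliDist {k : ℕ} (hk : 1 ≤ k) {c : ℕ} (hc : c.Coprime M')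
    (b₀ : ZMod M) :
    ∑ b ∈ Finset.univ.filter (fun b : ZMod M' ↦ ZMod.castHom hMM' (ZMod M) b = b₀),
        regBernoulliDist k M' c b = regBernoulliDist k M c b₀ := by
  unfold regBernoulliDist
  rw [Finset.sum_sub_distrib, ← Finset.mul_sum, sum_fiber_bernoulliDist hMM' hk,
    sum_fiber_mul_inv hMM' (bernoulliDist k M') hc, sum_fiber_bernoulliDist hMM' hk]

end Fiber

/-! ### E 1: the values of `E_{1,c}` -/

section EOne

variable {M : ℕ} [NeZero M] {c : ℕ}

/-- For `c` prime to `M` and `w = b c⁻¹ ∈ ℤ/Mℤ`: `c · w.val = b.val + tM` for some `t ∈ ℕ`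
(Lang's "we write `c⁻¹x = b + yN` with an integer `b` satisfying `0 ≤ b ≤ N − 1`", proof of **E 2**).
[cite: LangCyclotomic1990, Ch. 2 §2, proof of E 2 (PDF p. 35)] -/
theorem exists_mul_val_mul_inv_eq (hc : c.Coprime M) (b : ZMod M) :
    ∃ t : ℕ, c * (b * (c : ZMod M)⁻¹).val = b.val + t * M := by
  set w := b * (c : ZMod M)⁻¹ with hw
  have hcw : ((c * w.val : ℕ) : ZMod M) = b := by
    rw [Nat.cast_mul, ZMod.natCast_zmod_val, hw, mul_left_comm, ZMod.coe_mul_inv_eq_one c hc,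
      mul_one]
  have hmod : (c * w.val) % M = b.val := by
    have h := congr_arg ZMod.val hcw
    rwa [ZMod.val_natCast] at h
  refine ⟨c * w.val / M, ?_⟩
  have h := Nat.div_add_mod (c * w.val) M
  rw [hmod] at h
  rw [mul_comm (c * w.val / M) M]
  omega

/-- **Lang Ch. 2 §2, E 1**: `E_{1,c}^{(M)}(b) = ⟨b/M⟩ − c⟨c⁻¹b/M⟩ + (c−1)/2 = (c−1)/2 − t`, where
`t ∈ ℕ` is the integer with `c · (bc⁻¹).val = b.val + tM`.
[cite: LangCyclotomic1990, Ch. 2 §2, E 1 (PDF p. 35)] -/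
theorem regBernoulliDist_one_eq (b : ZMod M) {t : ℕ}
    (ht : c * (b * (c : ZMod M)⁻¹).val = b.val + t * M) :
    regBernoulliDist 1 M c b = ((c : ℚ) - 1) / 2 - t := by
  have hM : (M : ℚ) ≠ 0 := by exact_mod_cast NeZero.ne M
  have ht' : (c : ℚ) * ((b * (c : ZMod M)⁻¹).val : ℚ) = (b.val : ℚ) + (t : ℚ) * M := by
    exact_mod_cast ht
  unfold regBernoulliDist bernoulliDist
  simp only [Nat.sub_self, pow_zero, one_mul, pow_one, Polynomial.bernoulli_one,
    Polynomial.eval_sub, Polynomial.eval_X, Polynomial.eval_C]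
  have key : (c : ℚ) * (((b * (c : ZMod M)⁻¹).val : ℚ) / M - 2⁻¹) =
      ((b.val : ℚ) + (t : ℚ) * M) / M - (c : ℚ) * 2⁻¹ := by
    rw [mul_sub, ← mul_div_assoc, ht']
  rw [key]
  field_simp
  ring

/-- **Lang Ch. 2 §2, Thm. 2.1 (i) (at an odd prime `p`)**: the values of `E_{1,c}^{(M)}` are
`p`-integral, `‖E_{1,c}^{(M)}(b)‖_p ≤ 1` ("the expression for `E_{1,c}` is obviously `N`-integral
except possibly for the term `(c−1)/2`"). [cite: LangCyclotomic1990, Ch. 2 §2, Thm. 2.1 (i) (PDF p. 36)] -/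
theorem norm_regBernoulliDist_one_le_one (p : ℕ) [Fact p.Prime] (hp : p ≠ 2) (hc : c.Coprime M)
    (b : ZMod M) : ‖((regBernoulliDist 1 M c b : ℚ) : ℚ_[p])‖ ≤ 1 := by
  obtain ⟨t, ht⟩ := exists_mul_val_mul_inv_eq hc b
  rw [regBernoulliDist_one_eq b ht]
  have h2 : ‖(2 : ℚ_[p])‖ = 1 := by
    rw [show (2 : ℚ_[p]) = ((2 : ℕ) : ℚ_[p]) by norm_cast, Padic.norm_natCast_eq_one_iff]
    exact (Nat.coprime_primes (Fact.out : p.Prime) Nat.prime_two).mpr hp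
  have hsub : ∀ x y : ℚ_[p], ‖x - y‖ ≤ max ‖x‖ ‖y‖ := fun x y ↦ by
    simpa only [sub_eq_add_neg, norm_neg] using IsUltrametricDist.norm_add_le_max x (-y)
  push_cast
  refine (hsub _ _).trans (max_le ?_ ?_)
  · rw [norm_div, h2, div_one]
    refine (hsub _ _).trans (max_le ?_ (by rw [norm_one]))
    exact_mod_cast Padic.norm_int_le_one (c : ℤ)
  · exact_mod_cast Padic.norm_int_le_one (t : ℤ)

end EOne

/-! ### The twisted measures `θ E_{k,c}` on `ℤ_p` -/

section Measure

variable (p : ℕ) [Fact p.Prime] (N : ℕ) [NeZero N] (c : ℕ) (θ : ℕ → ℤ_[p]) (k : ℕ)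

/-- **The `θ`-twisted Bernoulli distribution `θ · E_{k,c}` of level `N` on `ℤ_p`**: for an
`N`-periodic function `θ : ℕ → ℤ_p` (a Dirichlet character "extended by `0`", Lang Ch. 2 §2 /
Ch. 4 §3: the measure `χ E_{1,c}`), an integer `c` prime to `Np` and `k ≥ 1`, the value on the
class `a + p^n ℤ_p` is
`μ(a + p^n ℤ_p) = ∑_{b ∈ ℤ/Np^nℤ, b ≡ a (p^n)} θ(b) E_{k,c}^{(Np^n)}(b) = ∫_{a + p^nℤ_p} θ dE_{k,c}`
(with Lang's `E_{k,c}^{(M)} = (1/k) · regBernoulliDist k M c`), an element of `ℚ_p`.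
[cite: LangCyclotomic1990, Ch. 2 §2 (E_{k,c}, PDF p. 35) and Ch. 4 §3 (the measure χE_{1,c}, PDF p. 84)] -/
def bernoulliMeasure (n : ℕ) (a : ZMod (p ^ n)) : ℚ_[p] :=
  ∑ b ∈ Finset.univ.filter (fun b : ZMod (N * p ^ n) ↦
      ZMod.castHom (Dvd.intro_left N rfl) (ZMod (p ^ n)) b = a),
    ((θ b.val : ℤ_[p]) : ℚ_[p]) * (((regBernoulliDist k (N * p ^ n) c b / k : ℚ)) : ℚ_[p])

variable {p N c θ k}

omit [Fact p.Prime] in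
/-- Reduction maps between the `ℤ/aℤ` compose. [folklore] -/
private theorem castHom_comp_apply {a b d : ℕ} (hab : a ∣ b) (hbd : b ∣ d) (x : ZMod d) :
    ZMod.castHom hab (ZMod a) (ZMod.castHom hbd (ZMod b) x) = ZMod.castHom (hab.trans hbd) (ZMod a) x :=
  RingHom.congr_fun (RingHom.ext_zmod ((ZMod.castHom hab (ZMod a)).comp
    (ZMod.castHom hbd (ZMod b))) (ZMod.castHom (hab.trans hbd) (ZMod a))) x

omit [Fact p.Prime] in
/-- Regrouping a sum over `ℤ/dℤ` along `ℤ/dℤ → ℤ/bℤ → ℤ/aℤ`: summing over the fibre of `x ∈ ℤ/aℤ`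
in `ℤ/dℤ` is summing, over the fibre of `x` in `ℤ/bℤ`, the sums over the fibres of `ℤ/dℤ → ℤ/bℤ`.
[folklore] -/
private theorem sum_fiber_fiber {a b d : ℕ} [NeZero b] [NeZero d] (hab : a ∣ b) (hbd : b ∣ d)
    {R : Type*} [AddCommMonoid R] (F : ZMod d → R) (x : ZMod a) :
    ∑ y ∈ Finset.univ.filter (fun y : ZMod b ↦ ZMod.castHom hab (ZMod a) y = x),
        ∑ z ∈ Finset.univ.filter (fun z : ZMod d ↦ ZMod.castHom hbd (ZMod b) z = y), F z =
      ∑ z ∈ Finset.univ.filter (fun z : ZMod d ↦ ZMod.castHom (hab.trans hbd) (ZMod a) z = x),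
        F z := by
  classical
  rw [← Finset.sum_fiberwise_of_maps_to
    (s := Finset.univ.filter (fun z : ZMod d ↦ ZMod.castHom (hab.trans hbd) (ZMod a) z = x))
    (t := Finset.univ.filter (fun y : ZMod b ↦ ZMod.castHom hab (ZMod a) y = x))
    (g := ZMod.castHom hbd (ZMod b))]
  · refine Finset.sum_congr rfl fun y hy ↦ Finset.sum_congr ?_ fun _ _ ↦ rfl
    ext z
    simp only [Finset.mem_filter, Finset.mem_univ, true_and]
    constructor
    · intro hz
      refine ⟨?_, hz⟩
      rw [← (Finset.mem_filter.mp hy).2, ← hz, castHom_comp_apply]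
    · exact fun h ↦ h.2
  · intro z hz
    simp only [Finset.mem_filter, Finset.mem_univ, true_and] at hz ⊢
    rw [castHom_comp_apply]
    exact hz

/-- **The distribution relation of `θ E_{k,c}` on the `p`-power tower** (Lang Ch. 2 §2: `E_{k,c}`
is a distribution on `{ℤ/Nℤ}`; here pushed forward to `{ℤ/p^nℤ}`): for `θ` of period `N`, `k ≥ 1`
and `c` prime to `Np`, `∑_{b ≡ a (p^n)} μ(b + p^{n+1}ℤ_p) = μ(a + p^nℤ_p)`.
[cite: LangCyclotomic1990, Ch. 2 §2, E_{k,c} and Thm. 2.1 (PDF pp. 35–36)] -/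
theorem sum_fiber_bernoulliMeasure (hc : c.Coprime (N * p)) (hθ : ∀ b, θ (b + N) = θ b)
    (hk : 1 ≤ k) (n : ℕ) (a : ZMod (p ^ n)) :
    ∑ b ∈ Finset.univ.filter (fun b : ZMod (p ^ (n + 1)) ↦
        ZMod.castHom (pow_dvd_pow p n.le_succ) (ZMod (p ^ n)) b = a),
      bernoulliMeasure p N c θ k (n + 1) b = bernoulliMeasure p N c θ k n a := by
  classical
  have hNN : N * p ^ n ∣ N * p ^ (n + 1) := mul_dvd_mul_left N (pow_dvd_pow p n.le_succ)
  have hc' : c.Coprime (N * p ^ (n + 1)) :=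
    Nat.Coprime.mul_right (Nat.Coprime.coprime_mul_right_right hc)
      (Nat.Coprime.pow_right _ (Nat.Coprime.coprime_mul_left_right hc))
  have hper : ∀ b m : ℕ, θ (b + m * N) = θ b := by
    intro b m
    induction m with
    | zero => rw [zero_mul, add_zero]
    | succ m ih => rw [Nat.succ_mul, ← add_assoc, hθ, ih]
  have hθ' : ∀ b j : ℕ, θ (b + j * (N * p ^ n)) = θ b := by
    intro b j
    rw [show b + j * (N * p ^ n) = b + (j * p ^ n) * N by ring, hper]
  unfold bernoulliMeasure
  -- regroup the double sum along `ℤ/Np^{n+1} → ℤ/p^{n+1} → ℤ/p^n`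
  rw [sum_fiber_fiber (pow_dvd_pow p n.le_succ) (Dvd.intro_left N rfl)]
  -- and split it along `ℤ/Np^{n+1} → ℤ/Np^n → ℤ/p^n`
  rw [show (pow_dvd_pow p n.le_succ).trans (Dvd.intro_left N rfl) =
      (Dvd.intro_left N rfl : p ^ n ∣ N * p ^ n).trans hNN from rfl,
    ← sum_fiber_fiber (Dvd.intro_left N rfl) hNN]
  refine Finset.sum_congr rfl fun b₀ _ ↦ ?_
  -- on the fibre of `b₀`, `θ(b.val) = θ(b₀.val)`
  have hθfib : ∀ b ∈ Finset.univ.filter (fun b : ZMod (N * p ^ (n + 1)) ↦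
      ZMod.castHom hNN (ZMod (N * p ^ n)) b = b₀), θ b.val = θ b₀.val := by
    intro b hb
    have hb' := (Finset.mem_filter.mp hb).2
    have hval : b.val % (N * p ^ n) = b₀.val := by
      have h := congr_arg ZMod.val hb'
      rwa [ZMod.castHom_apply, ZMod.cast_eq_val, ZMod.val_natCast] at h
    rw [← Nat.mod_add_div' b.val (N * p ^ n), hval, hθ']
  rw [Finset.sum_congr rfl fun b hb ↦ by rw [hθfib b hb], ← Finset.mul_sum]
  congr 1
  have h := sum_fiber_regBernoulliDist hNN hk hc' b₀
  have h' : (((regBernoulliDist k (N * p ^ n) c b₀ / k : ℚ)) : ℚ_[p]) =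
      (((∑ b ∈ Finset.univ.filter (fun b : ZMod (N * p ^ (n + 1)) ↦
        ZMod.castHom hNN (ZMod (N * p ^ n)) b = b₀), regBernoulliDist k (N * p ^ (n + 1)) c b) / k :
        ℚ) : ℚ_[p]) := by rw [h]
  rw [h', Finset.sum_div]
  push_cast
  rfl

end Measure

end Literature.NumberTheory.EllipticCurves

end
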